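import Literature.Computability.Complexity.CHPrimes
import HarnessLib

/-!
# Iterated products modulo short primes inside the counting hierarchy

Seventh toolkit file (theorems only) of the scaled-up `FOM + MAJ` calculus: Step 2 of the
Hesse–Allender–Barrington algorithm ("if the input and output are in CRR, the iterated
multiplication problem simply reduces to the iterated addition problem (by adding the discrete
logs): in order to compute `∏ Aᵢ mod p`, where `Aᵢ ≡ g^{ℓᵢ} mod p`, we simply compute `b = ∑ ℓᵢ` and
output `gᵇ mod p`", JCSS 65 (2002), §4), scaled up to `CH` as in Bürgisser's proof of Thm. 3.7
(ECCC TR06-113, p. 12: "`δ(n) = ∑ₖ α(n, k)` is definable in `CH`. Hence `d(n) mod p = g^{γ(n)}` is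
computable in `CH`").

**Theorem** (`iterProdModGraph_mem_CH`): if a family `a ⟨u, bin k⟩` of short numbers has a `CH`
graph, then so has `⟨u, m⟩ ↦ (∏_{k < 2^{p|u|}} a ⟨u, bin k⟩) mod val m` (for prime `val m`; `0`
otherwise) — the Chinese remainder representation of an iterated product.

## References

* W. Hesse, E. Allender, D. A. M. Barrington, JCSS 65 (2002), §4, Step 2.
* P. Bürgisser, ECCC TR06-113 (2006), Thm. 3.7(1) and its proof.
-/

namespace Literature.Computability.Complexity

open _root_.Computability Polynomial PRelSigma TTClosure Brick PPSharpP ThresholdPP Plumb Finset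

section IterProd

variable {a : List Bool → ℕ} {q : Polynomial ℕ} (p : Polynomial ℕ)

/-! ### The discrete logarithms of the factors and their sum -/

/-- The discrete logarithm is at most the modulus. [folklore] -/
theorem dlog_le (m b : ℕ) :
    (if h : m.Prime ∧ b % m ≠ 0 then Nat.find (exists_dlog h) else 0) ≤ m := by
  split_ifs with h
  · exact ((pow_dlog_mod_eq h).1.le.trans (Nat.sub_le _ _))
  · exact Nat.zero_le _

/-- The summand: on `w' = ⟨w, bin k⟩`, `w = ⟨u, m⟩`, the discrete logarithm of `a ⟨u, bin k⟩`
modulo `val m`. Its graph is in `CH` (binary composition of `dlogGraph_mem_CH`). [cite: Burgisser2006, Theorem 3.7] -/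
theorem dlogTermGraph_mem_CH (ha : {z | a (fstP z) = bitsToNat (sndP z)} ∈ CH) (hb : ∀ w, a w < 2 ^ q.eval w.length) :
    {z | (if h : (bitsToNat (sndP (fstP (fstP z)))).Prime ∧
          a (pairFn (fstP ∘ fstP) sndP (fstP z)) % bitsToNat (sndP (fstP (fstP z))) ≠ 0
        then Nat.find (exists_dlog h) else 0) = bitsToNat (sndP z)} ∈ CH := by
  obtain ⟨s, hs⟩ := exists_poly_length_le_of_mem_FP (pairFn_mem_FP (comp_mem_FP fstP_mem_FP fstP_mem_FP) sndP_mem_FP)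
  have h1 : {z | bitsToNat (sndP (fstP (fstP z))) = bitsToNat (sndP z)} ∈ CH :=
    mem_CH_of_iff (P_subset_CH (preimage_mem_P eqVal_mem_P (pairFn_mem_FP (comp_mem_FP sndP_mem_FP (comp_mem_FP fstP_mem_FP fstP_mem_FP))
      sndP_mem_FP))) _ fun z => by
      change _ ↔ bitsToNat (fstP (pairFn (sndP ∘ fstP ∘ fstP) sndP z)) = bitsToNat (sndP (pairFn (sndP ∘ fstP ∘ fstP) sndP z))
      rw [pairFn_apply, fstP_boolPair, sndP_boolPair]; rfl
  have hb1 : ∀ w, bitsToNat (sndP (fstP w)) < 2 ^ (X : Polynomial ℕ).eval w.length := fun w =>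
    (val_lt_two_pow_eval_X _).trans_le (Nat.pow_le_pow_right (by norm_num) (by
      rw [eval_X, eval_X]; exact ((Nat.le_add_left _ _).trans (length_components_le'' (fstP w))).trans (length_fstP_le w)))
  exact comp₂_graph_mem_CH (op := fun m b => if h : m.Prime ∧ b % m ≠ 0 then Nat.find (exists_dlog h) else 0)
    (mem_CH_of_iff dlogGraph_mem_CH _ fun u => Iff.rfl)
    (f₁ := fun w => bitsToNat (sndP (fstP w))) (p₁ := X) h1 hb1
    (f₂ := fun w => a (pairFn (fstP ∘ fstP) sndP w)) (graph_comp_FP_mem_CH ha (pairFn_mem_FP (comp_mem_FP fstP_mem_FP fstP_mem_FP) sndP_mem_FP))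
    (bound_comp_FP hb hs)
where
  /-- `|fstP w| + |sndP w| ≤ |w|`. [folklore] -/
  length_components_le'' (w : List Bool) : (fstP w).length + (sndP w).length ≤ w.length := by
    have h := length_fstF_sndF_le w
    change 2 * (fstP w).length + (sndP w).length ≤ _ at h
    omega

/-- The summand read at `w' = ⟨w, bin k⟩`. [folklore] -/
theorem dlogTerm_apply (w : List Bool) (k : ℕ) :
    (if h : (bitsToNat (sndP (fstP (boolPair w (encodeNat k))))).Prime ∧
          a (pairFn (fstP ∘ fstP) sndP (boolPair w (encodeNat k))) % bitsToNat (sndP (fstP (boolPair w (encodeNat k)))) ≠ 0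
        then Nat.find (exists_dlog h) else 0) =
      (if h : (bitsToNat (sndP w)).Prime ∧ a (boolPair (fstP w) (encodeNat k)) % bitsToNat (sndP w) ≠ 0
        then Nat.find (exists_dlog h) else 0) := by
  simp only [pairFn_apply, Function.comp_apply, fstP_boolPair, sndP_boolPair]

/-- The summand is `< 2^{|w'|}`. [folklore] -/
theorem dlogTerm_lt_two_pow (a : List Bool → ℕ) (w : List Bool) :
    (if h : (bitsToNat (sndP (fstP w))).Prime ∧ a (pairFn (fstP ∘ fstP) sndP w) % bitsToNat (sndP (fstP w)) ≠ 0
        then Nat.find (exists_dlog h) else 0) < 2 ^ (X : Polynomial ℕ).eval w.length := by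
  refine (dlog_le _ _).trans_lt ((val_lt_two_pow_eval_X _).trans_le (Nat.pow_le_pow_right (by norm_num) ?_))
  rw [eval_X, eval_X]
  have h := length_fstF_sndF_le (fstP w)
  change 2 * (fstP (fstP w)).length + (sndP (fstP w)).length ≤ _ at h
  have := length_fstP_le w
  omega

/-- **The sum of the discrete logarithms has a `CH` graph**: on `w = ⟨u, m⟩`,
`E w = ∑_{k < 2^{p|u|}} dlog (a ⟨u, bin k⟩ mod val m)` (sum rule; "`δ(n) = ∑ₖ α(n,k)` is definable in
`CH`", Bürgisser 2006, p. 12). [cite: Burgisser2006, Theorem 3.7] -/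
theorem dlogSumGraph_mem_CH (ha : {z | a (fstP z) = bitsToNat (sndP z)} ∈ CH) (hb : ∀ w, a w < 2 ^ q.eval w.length) :
    {z | (∑ k ∈ range (2 ^ p.eval (fstP (fstP z)).length),
        (if h : (bitsToNat (sndP (fstP z))).Prime ∧ a (boolPair (fstP (fstP z)) (encodeNat k)) % bitsToNat (sndP (fstP z)) ≠ 0
          then Nat.find (exists_dlog h) else 0)) = bitsToNat (sndP z)} ∈ CH := by
  refine mem_CH_of_iff (sumGraph_fst_mem_CH (dlogTermGraph_mem_CH ha hb) (dlogTerm_lt_two_pow a) p) _ fun z => ?_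
  change _ ↔ (∑ i ∈ range (2 ^ p.eval (fstP (fstP z)).length), _) = bitsToNat (sndP z)
  simp only [dlogTerm_apply]
  exact Iff.rfl

/-- Bit-size of the sum of discrete logarithms: `E ⟨u, m⟩ < 2^{(p + X + 1)(|w|)}`. [folklore] -/
theorem dlogSum_lt_two_pow (a : List Bool → ℕ) (w : List Bool) :
    (∑ k ∈ range (2 ^ p.eval (fstP w).length),
        (if h : (bitsToNat (sndP w)).Prime ∧ a (boolPair (fstP w) (encodeNat k)) % bitsToNat (sndP w) ≠ 0
          then Nat.find (exists_dlog h) else 0)) < 2 ^ (p + X + 1).eval w.length := by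
  have hle : ∀ k ∈ range (2 ^ p.eval (fstP w).length),
      (if h : (bitsToNat (sndP w)).Prime ∧ a (boolPair (fstP w) (encodeNat k)) % bitsToNat (sndP w) ≠ 0
          then Nat.find (exists_dlog h) else 0) ≤ 2 ^ w.length := fun k _ =>
    (dlog_le _ _).trans ((bitsToNat_lt _).le.trans (Nat.pow_le_pow_right (by norm_num) (by
      have h := length_fstF_sndF_le w
      change 2 * (fstP w).length + (sndP w).length ≤ _ at h
      omega)))
  refine (sum_le_sum hle).trans_lt ?_
  rw [sum_const, card_range, smul_eq_mul, ← pow_add]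
  refine Nat.pow_lt_pow_right (by norm_num) ?_
  simp only [eval_add, eval_X, eval_one]
  have := TM2Iter.eval_mono p (length_fstP_le w)
  omega

/-! ### Vanishing factors -/

/-- **"Some factor vanishes modulo `m`" is a `CH` predicate**: on `w = ⟨u, m⟩`,
`∃ k < 2^{p|u|}, a ⟨u, bin k⟩ mod val m = 0` ("we can check for given `n` in `CH` whether all
`a(n, k)` are nonzero", Bürgisser 2006, p. 12). [cite: Burgisser2006, Theorem 3.7] -/
theorem existsZeroFactor_mem_CH (ha : {z | a (fstP z) = bitsToNat (sndP z)} ∈ CH) (hb : ∀ w, a w < 2 ^ q.eval w.length) :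
    {w | ∃ k < 2 ^ p.eval (fstP w).length, a (boolPair (fstP w) (encodeNat k)) % bitsToNat (sndP w) = 0} ∈ CH := by
  obtain ⟨s, hs⟩ := exists_poly_length_le_of_mem_FP (pairFn_mem_FP (comp_mem_FP fstP_mem_FP fstP_mem_FP) sndP_mem_FP)
  -- the function `w' ↦ a ⟨u, bin k⟩ mod val m` on `w' = ⟨⟨u, m⟩, bin k⟩`
  have h1 : {z | bitsToNat (sndP (fstP (fstP z))) = bitsToNat (sndP z)} ∈ CH :=
    mem_CH_of_iff (P_subset_CH (preimage_mem_P eqVal_mem_P (pairFn_mem_FP (comp_mem_FP sndP_mem_FP (comp_mem_FP fstP_mem_FP fstP_mem_FP))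
      sndP_mem_FP))) _ fun z => by
      change _ ↔ bitsToNat (fstP (pairFn (sndP ∘ fstP ∘ fstP) sndP z)) = bitsToNat (sndP (pairFn (sndP ∘ fstP ∘ fstP) sndP z))
      rw [pairFn_apply, fstP_boolPair, sndP_boolPair]; rfl
  have hb1 : ∀ w, bitsToNat (sndP (fstP w)) < 2 ^ (X : Polynomial ℕ).eval w.length := fun w =>
    (val_lt_two_pow_eval_X _).trans_le (Nat.pow_le_pow_right (by norm_num) (by
      rw [eval_X, eval_X]
      have h := length_fstF_sndF_le (fstP w)
      change 2 * (fstP (fstP w)).length + (sndP (fstP w)).length ≤ _ at h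
      have := length_fstP_le w
      omega))
  have hMod := comp₂_graph_mem_CH (op := fun b m => b % m) (P_subset_CH modGraph_mem_P)
    (f₁ := fun w => a (pairFn (fstP ∘ fstP) sndP w))
    (graph_comp_FP_mem_CH ha (pairFn_mem_FP (comp_mem_FP fstP_mem_FP fstP_mem_FP) sndP_mem_FP)) (bound_comp_FP hb hs)
    (f₂ := fun w => bitsToNat (sndP (fstP w))) (p₂ := X) h1 hb1
  -- `Inner = {w' | |sndP w'| ≤ p|u| ∧ value = 0}`
  have hZero := preimage_mem_CH hMod (pairFn_mem_FP OracleCompose.id_mem_FP (const_mem_FP []))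
  have hCut : ({w | (sndP w).length ≤ p.eval (fstP (fstP w)).length} : Language Bool) ∈ Classes.P :=
    mem_P_of_iff (preimage_mem_P (LenLe_mem_P p) (pairFn_mem_FP (comp_mem_FP fstP_mem_FP fstP_mem_FP) sndP_mem_FP)) _ fun w => by
      change _ ↔ pairFn (fstP ∘ fstP) sndP w ∈ LenLe p
      rw [pairFn_apply, boolPair_mem_LenLe]; rfl
  refine mem_CH_of_iff (exists_lt_mem_CH (inter_P_mem_CH hCut hZero) p) _ fun w => ?_
  change (∃ k < 2 ^ p.eval (fstP w).length, a (boolPair (fstP w) (encodeNat k)) % bitsToNat (sndP w) = 0) ↔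
    ∃ v < 2 ^ p.eval w.length, (sndP (boolPair w (encodeNat v))).length ≤ p.eval (fstP (fstP (boolPair w (encodeNat v)))).length ∧
    a (pairFn (fstP ∘ fstP) sndP (fstP (pairFn id (fun _ => []) (boolPair w (encodeNat v))))) %
        bitsToNat (sndP (fstP (fstP (pairFn id (fun _ => []) (boolPair w (encodeNat v)))))) =
      bitsToNat (sndP (pairFn id (fun _ => []) (boolPair w (encodeNat v))))
  simp only [pairFn_apply, Function.comp_apply, fstP_boolPair, sndP_boolPair, bitsToNat_nil, id, Brick.length_encodeNat_le_iff]
  constructor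
  · rintro ⟨k, hk, h0⟩
    exact ⟨k, hk.trans_le (Nat.pow_le_pow_right (by norm_num) (TM2Iter.eval_mono p (length_fstP_le w))), hk, h0⟩
  · rintro ⟨k, -, hk, h0⟩
    exact ⟨k, hk, h0⟩


/-! ### The power `g^{E mod (m-1)} mod m` and the assembly -/

/-- The reduced exponent `E w mod (val m - 1)` has a `CH` graph. [folklore] -/
theorem redExpGraph_mem_CH (ha : {z | a (fstP z) = bitsToNat (sndP z)} ∈ CH) (hb : ∀ w, a w < 2 ^ q.eval w.length) :
    {z | (∑ k ∈ range (2 ^ p.eval (fstP (fstP z)).length),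
        (if h : (bitsToNat (sndP (fstP z))).Prime ∧ a (boolPair (fstP (fstP z)) (encodeNat k)) % bitsToNat (sndP (fstP z)) ≠ 0
          then Nat.find (exists_dlog h) else 0)) % (bitsToNat (sndP (fstP z)) - 1) = bitsToNat (sndP z)} ∈ CH := by
  have hop : ({u | bitsToNat (fstP (fstP u)) % (bitsToNat (sndP (fstP u)) - 1) = bitsToNat (sndP u)} : Language Bool) ∈ Classes.P :=
    mem_P_of_iff (graphFP_mem_P (comp_mem_FP remFn_mem_FP (pairFn_mem_FP fstP_mem_FP
      (comp_mem_FP subFn_mem_FP (pairFn_mem_FP sndP_mem_FP (const_mem_FP (encodeNat 1))))))) _ fun u => by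
      change _ ↔ bitsToNat ((remFn ∘ pairFn fstP (subFn ∘ pairFn sndP fun _ => encodeNat 1)) (fstP u)) = bitsToNat (sndP u)
      simp only [Function.comp_apply, pairFn_apply, remFn_boolPair, subFn_boolPair, bitsToNat_encodeNat]
      rfl
  have h2 : {z | bitsToNat (sndP (fstP z)) = bitsToNat (sndP z)} ∈ CH :=
    mem_CH_of_iff (P_subset_CH (preimage_mem_P eqVal_mem_P (pairFn_mem_FP (comp_mem_FP sndP_mem_FP fstP_mem_FP) sndP_mem_FP))) _
      fun z => by
        change _ ↔ bitsToNat (fstP (pairFn (sndP ∘ fstP) sndP z)) = bitsToNat (sndP (pairFn (sndP ∘ fstP) sndP z))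
        rw [pairFn_apply, fstP_boolPair, sndP_boolPair]; rfl
  exact comp₂_graph_mem_CH (op := fun e m => e % (m - 1)) (P_subset_CH hop)
    (dlogSumGraph_mem_CH p ha hb) (dlogSum_lt_two_pow p a)
    (f₂ := fun w => bitsToNat (sndP w)) (p₂ := X) h2 (fun w => (val_lt_two_pow_eval_X (sndP w)).trans_le
      (Nat.pow_le_pow_right (by norm_num) (by
        rw [eval_X, eval_X]
        have h := length_fstF_sndF_le w
        change 2 * (fstP w).length + (sndP w).length ≤ _ at h
        omega)))

/-- The reduced exponent is below `2^{|w|}` (it is `< val m` or `0`). [folklore] -/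
theorem redExp_lt_two_pow (a : List Bool → ℕ) (w : List Bool) :
    (∑ k ∈ range (2 ^ p.eval (fstP w).length),
        (if h : (bitsToNat (sndP w)).Prime ∧ a (boolPair (fstP w) (encodeNat k)) % bitsToNat (sndP w) ≠ 0
          then Nat.find (exists_dlog h) else 0)) % (bitsToNat (sndP w) - 1) < 2 ^ (p + X + 1).eval w.length :=
  (Nat.mod_le _ _).trans_lt (dlogSum_lt_two_pow p a w)

/-- **The power term `g^{E mod (m-1)} mod m` has a `CH` graph** (`g` the least generator of
`(ℤ/m)ˣ`, `E` the sum of discrete logarithms): two substitutions into the `P` atom of modular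
exponentiation ("`d(n) mod p = g^{γ(n)}` is computable in `CH`", Bürgisser 2006, p. 12). [cite: Burgisser2006, Theorem 3.7] -/
theorem powTermGraph_mem_CH (ha : {z | a (fstP z) = bitsToNat (sndP z)} ∈ CH) (hb : ∀ w, a w < 2 ^ q.eval w.length) :
    {z | (if bitsToNat (sndP (fstP z)) ≤ 1 then 0
        else (if h : (bitsToNat (sndP (fstP z))).Prime then Nat.find (exists_genTest h) else 0) ^
          ((∑ k ∈ range (2 ^ p.eval (fstP (fstP z)).length),
            (if h : (bitsToNat (sndP (fstP z))).Prime ∧ a (boolPair (fstP (fstP z)) (encodeNat k)) % bitsToNat (sndP (fstP z)) ≠ 0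
              then Nat.find (exists_dlog h) else 0)) % (bitsToNat (sndP (fstP z)) - 1)) % bitsToNat (sndP (fstP z))) =
      bitsToNat (sndP z)} ∈ CH := by
  -- `R₀ = {⟨bin g', ⟨bin e', ⟨w, ν⟩⟩⟩ | pm(g', e', val (sndP w)) = val ν}`
  have hR₀ : (pairFn (pairFn fstP (pairFn (fstP ∘ sndP) (sndP ∘ fstP ∘ sndP ∘ sndP))) (sndP ∘ sndP ∘ sndP) ⁻¹'
      ({z | (if bitsToNat (sndP (sndP (fstP z))) ≤ 1 then 0
        else bitsToNat (fstP (fstP z)) ^ bitsToNat (fstP (sndP (fstP z))) % bitsToNat (sndP (sndP (fstP z)))) =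
        bitsToNat (sndP z)} : Language Bool)) ∈ Classes.P :=
    preimage_mem_P powModGraph_mem_P (pairFn_mem_FP (pairFn_mem_FP fstP_mem_FP
      (pairFn_mem_FP (comp_mem_FP fstP_mem_FP sndP_mem_FP) (comp_mem_FP sndP_mem_FP (comp_mem_FP fstP_mem_FP (comp_mem_FP sndP_mem_FP sndP_mem_FP)))))
      (comp_mem_FP sndP_mem_FP (comp_mem_FP sndP_mem_FP sndP_mem_FP)))
  -- substitute the least generator of `val (sndP w)` (read off `r' = ⟨bin e', ⟨w, ν⟩⟩`)
  have hR₁ := rel_apply_mem_CH (P_subset_CH hR₀)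
    (f := fun x => if h : (bitsToNat x).Prime then Nat.find (exists_genTest h) else 0)
    (mem_CH_of_iff leastGenGraph_mem_CH _ fun u => Iff.rfl) leastGen_lt_two_pow
    (comp_mem_FP sndP_mem_FP (comp_mem_FP fstP_mem_FP sndP_mem_FP))
  -- substitute the reduced exponent (read off `z = ⟨w, ν⟩`)
  have hR₂ := rel_apply_mem_CH hR₁ (redExpGraph_mem_CH p ha hb) (redExp_lt_two_pow p a) fstP_mem_FP
  refine mem_CH_of_iff hR₂ _ fun z => ?_
  -- unfold the two substitutions
  have key : ∀ (F : List Bool → List Bool) (r : List Bool),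
      r ∈ F ⁻¹' {z | (if bitsToNat (sndP (sndP (fstP z))) ≤ 1 then 0
        else bitsToNat (fstP (fstP z)) ^ bitsToNat (fstP (sndP (fstP z))) % bitsToNat (sndP (sndP (fstP z)))) =
        bitsToNat (sndP z)} ↔
      (fun z => (if bitsToNat (sndP (sndP (fstP z))) ≤ 1 then 0
        else bitsToNat (fstP (fstP z)) ^ bitsToNat (fstP (sndP (fstP z))) % bitsToNat (sndP (sndP (fstP z)))) =
        bitsToNat (sndP z)) (F r) := fun F r => Iff.rfl
  refine Iff.trans ?_ (key _ _).symm
  simp only [pairFn_apply, Function.comp_apply, fstP_boolPair, sndP_boolPair, bitsToNat_encodeNat]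
  exact Iff.rfl

/-- **Iterated products modulo short primes are `CH`-definable** (HAB 2002, §4, Step 2, scaled;
Bürgisser 2006, proof of Thm. 3.7(1)): if the family `a ⟨u, bin k⟩` has a `CH` graph and
polynomial bit-size, then on `w = ⟨u, m⟩` the function
`(∏_{k < 2^{p|u|}} a ⟨u, bin k⟩) mod val m` (for prime `val m`; `0` otherwise) has a `CH` graph:
it is `0` if some factor vanishes modulo `m`, and `g^{(∑ₖ dlog aₖ) mod (m-1)} mod m` otherwise. [cite: Burgisser2006, Theorem 3.7] -/
theorem iterProdModGraph_mem_CH (ha : {z | a (fstP z) = bitsToNat (sndP z)} ∈ CH) (hb : ∀ w, a w < 2 ^ q.eval w.length) :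
    {z | (if (bitsToNat (sndP (fstP z))).Prime then
          (∏ k ∈ range (2 ^ p.eval (fstP (fstP z)).length), a (boolPair (fstP (fstP z)) (encodeNat k))) %
            bitsToNat (sndP (fstP z))
        else 0) = bitsToNat (sndP z)} ∈ CH := by
  have hPr : ({w | (bitsToNat (sndP w)).Prime} : Language Bool) ∈ CH := preimage_mem_CH primeVal_mem_CH sndP_mem_FP
  have hZ := existsZeroFactor_mem_CH p ha hb
  have hzero : {z | (fun _ : List Bool => (0 : ℕ)) (fstP z) = bitsToNat (sndP z)} ∈ CH :=
    mem_CH_of_iff (P_subset_CH (preimage_mem_P valZero_mem_P sndP_mem_FP)) _ fun z => by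
      change (0 : ℕ) = bitsToNat (sndP z) ↔ bitsToNat (sndP z) = 0
      exact eq_comm
  have hInner := iteGraph_mem_CH' hZ (f := fun _ => 0) hzero
    (g := fun w => if bitsToNat (sndP w) ≤ 1 then 0
        else (if h : (bitsToNat (sndP w)).Prime then Nat.find (exists_genTest h) else 0) ^
          ((∑ k ∈ range (2 ^ p.eval (fstP w).length),
            (if h : (bitsToNat (sndP w)).Prime ∧ a (boolPair (fstP w) (encodeNat k)) % bitsToNat (sndP w) ≠ 0
              then Nat.find (exists_dlog h) else 0)) % (bitsToNat (sndP w) - 1)) % bitsToNat (sndP w))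
    (powTermGraph_mem_CH p ha hb)
  have hR := iteGraph_mem_CH' hPr
    (f := fun w => if (∃ k < 2 ^ p.eval (fstP w).length, a (boolPair (fstP w) (encodeNat k)) % bitsToNat (sndP w) = 0) then 0
      else (if bitsToNat (sndP w) ≤ 1 then 0
        else (if h : (bitsToNat (sndP w)).Prime then Nat.find (exists_genTest h) else 0) ^
          ((∑ k ∈ range (2 ^ p.eval (fstP w).length),
            (if h : (bitsToNat (sndP w)).Prime ∧ a (boolPair (fstP w) (encodeNat k)) % bitsToNat (sndP w) ≠ 0
              then Nat.find (exists_dlog h) else 0)) % (bitsToNat (sndP w) - 1)) % bitsToNat (sndP w)))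
    (g := fun _ => 0) hInner hzero
  refine mem_CH_of_iff hR _ fun z => ?_
  change (if (bitsToNat (sndP (fstP z))).Prime then _ else 0) = bitsToNat (sndP z) ↔
    (if (bitsToNat (sndP (fstP z))).Prime then
      (if (∃ k < 2 ^ p.eval (fstP (fstP z)).length, a (boolPair (fstP (fstP z)) (encodeNat k)) % bitsToNat (sndP (fstP z)) = 0)
        then 0 else _) else 0) = bitsToNat (sndP z)
  by_cases hm : (bitsToNat (sndP (fstP z))).Prime
  · rw [if_pos hm, if_pos hm]
    -- abbreviations
    have hm2 := hm.two_le
    by_cases hzf : ∃ k < 2 ^ p.eval (fstP (fstP z)).length, a (boolPair (fstP (fstP z)) (encodeNat k)) % bitsToNat (sndP (fstP z)) = 0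
    · rw [if_pos hzf]
      obtain ⟨k, hk, hk0⟩ := hzf
      rw [(prod_mod_prime_eq_zero_iff _ hm _).2 ⟨k, mem_range.2 hk, hk0⟩]
    · rw [if_neg hzf, if_neg (by omega), dif_pos hm]
      push Not at hzf
      obtain ⟨hg0, hgp, hord⟩ := leastGen_spec hm
      rw [prod_mod_prime_eq_pow_sum_dlog (range (2 ^ p.eval (fstP (fstP z)).length)) hm hg0 hgp
        (fun k => a (boolPair (fstP (fstP z)) (encodeNat k)))
        (fun k => if h : (bitsToNat (sndP (fstP z))).Prime ∧ a (boolPair (fstP (fstP z)) (encodeNat k)) % bitsToNat (sndP (fstP z)) ≠ 0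
          then Nat.find (exists_dlog h) else 0) fun k hk => ?_]
      have hk' : (bitsToNat (sndP (fstP z))).Prime ∧ a (boolPair (fstP (fstP z)) (encodeNat k)) % bitsToNat (sndP (fstP z)) ≠ 0 :=
        ⟨hm, hzf k (mem_range.1 hk)⟩
      rw [dif_pos hk']
      exact (pow_dlog_mod_eq hk').2
  · rw [if_neg hm, if_neg hm]

end IterProd

end Literature.Computability.Complexity
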